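import Literature.Barriers.CriticalPhenomena.WeaklySAWFrozenCutoff
import Literature.Barriers.CriticalPhenomena.WeaklySAWFlowContinuityCutoff
import Literature.Barriers.CriticalPhenomena.WeaklySAWPerturbativeFlow
import HarnessLib

/-!
# BBS 2015, §7.3, Step 2 of the proof of Proposition 7.1.1, modulo (A3): continuity of the critical
# flow of the 4d weakly SAW in `(m², K₀, g₀)` on a patch around `m̃² > 0`, weights frozen at `χ̃ = χ(m̃²)`

Source: Bauerschmidt–Brydges–Slade, CMP 337 (2015) [BBS2015], §7.3: "Application of Theorem 7.2.1 with
a single value `(m̃², g̃₀)` then produces a local solution … defined for each `(m², g₀)` in a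
neighbourhood of `(m̃², g̃₀)`. In steps 2–3, we subsequently show that these local solutions can be
combined into a single continuous solution … Step 2. Proof of continuity of `z₀ᶜ, μ₀ᶜ` in the interior
of their domains", the domains (Djdef-2) being taken "with `χ̃_j = χ_j(m̃²)`".

For the explicit `φ̄(m²) = wsawQuadFlow L m²` this file assembles all of Step 2 that does not involve the
RG map `(ψ, ρ)` (whose estimates (A3) are [BS-rg-step]): the frozen-cut-off hypotheses
(`cutoffQuadHyp_wsaw_frozen`: (A1)–(A2) with constants `(B', c', C')` on `[0,δ]` AND the hypotheses of
Lemmas 2.1–2.2 at the frozen cut-off `k̃ = j_Ω(β(m̃²))` on the patch `|m² - m̃²| ≤ ½m̃²`), the continuity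
of the coefficients (`coeffContinuous_wsawQuadFlow`), and Corollary 1.8 at a fixed cut-off
(`critFlowK_continuousWithinAt`).

* `massPatch δ m̃²` — the patch `{m² ∈ (0,δ] : |m² - m̃²| ≤ ½m̃²}`;
* **`BBS2015_cor722_frozen_of_hypA3`** — for `L ≥ 2`, `Ω > 1`, the package constants
  `(δ, B', c', C', g_*)`, a centre `m̃² ∈ (0,δ]`, constants of Theorem 7.2.1 with `𝗁` so large that
  `g_*(𝗁) ≤ g_*`, any Banach spaces and maps `ψ(m²), ρ(m²)` jointly continuous in `(m², x)` on the
  frozen domains: the critical flow `x(m², K₀, g₀)` of `BBS_thm14_exists_flow_cutoff` at the cut-off `k̃`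
  — in particular `(z₀ᶜ, μ₀ᶜ)(m², K₀, g₀) = (x₀).2` — is continuous at every admissible point of the patch
  within the admissible set (where (A3) with the frozen weights holds). No hypothesis on `m² ↦ χ_j(m²)`.
-/

noncomputable section

open Set Filter Topology

namespace Literature.Barriers.CriticalPhenomena

namespace CTWSAW

/-- The patch of masses around `m̃²`: `m² ∈ (0, δ]` with `|m² - m̃²| ≤ ½m̃²`.
[cite: BauerschmidtBrydgesSlade2015LogCorr, §7.3 ("for each (m², g₀) in a neighbourhood of (m̃², g̃₀)")] -/
abbrev massPatch (δ s0 : ℝ) : Type := {s : ℝ // 0 < s ∧ s ≤ δ ∧ |s - s0| ≤ 1 / 2 * s0}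

/-- **BBS 2015, §7.3 Step 2 for the 4d weakly SAW, modulo (A3)** (Corollary 7.2.2 on a patch with frozen
weights): let `δ, B', c', C', g_*` be as in `cutoffQuadHyp_wsaw_frozen` (`hpack`), `m̃² ∈ (0,δ]`,
`k̃ = j_Ω(β(m̃²))`; let the constants satisfy `ConstHyp` (with `λ = L²`) and `g_*(𝗁) ≤ g_*`; let
`ψ(m²), ρ(m²)` be jointly continuous in `(m², x)` at the points of the frozen domains. Then at every
admissible `q₀ = (m², K₀, g₀)` of the patch (`0 < g₀ ≤ g_*(𝗁)`, `‖K₀‖ ≤ a_*g₀³`, (A3) with the frozen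
weights), the critical flow `x_j(m², K₀, g₀)` is continuous within the admissible set, for every `j`.
[cite: BauerschmidtBrydgesSlade2015LogCorr, §7.3 (Step 2 of the proof of Proposition 7.1.1) and Corollary 7.2.2] [cite: BauerschmidtBrydgesSlade2015Flow, Corollary 1.8] -/
theorem BBS2015_cor722_frozen_of_hypA3 {L : ℝ} (hL : 2 ≤ L) {Ω : ℝ} {δ B' c' C' gs : ℝ}
    (hpack : (∀ s : ℝ, 0 ≤ s → s ≤ δ →
        HypA1 (wsawQuadFlow L s).β Ω B' c' ∧ HypA2 (wsawQuadFlow L s) Ω (L ^ 2) c' C') ∧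
      ∀ s0 s : ℝ, 0 < s0 → s0 ≤ δ → 0 < s → s ≤ δ → |s - s0| ≤ 1 / 2 * s0 →
        ∀ g₀ : ℝ, 0 < g₀ → g₀ ≤ gs →
          CutoffQuadHyp (wsawQuadFlow L s) Ω (jOmega (betaPT 4 L s0) Ω) B' c' ⌊c'⁻¹⌋₊ C' (L ^ 2) g₀)
    {s0 : ℝ} (hs0 : 0 < s0) (hs0δ : s0 ≤ δ)
    {a κ R M aStar b hh : ℝ} (hc : ConstHyp Ω c' (L ^ 2) C' a κ R M aStar b hh)
    (hgT : gThreshold Ω B' c' C' (L ^ 2) M a aStar κ R b hh ≤ gs)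
    {W : ℕ → Type*} [∀ j, NormedAddCommGroup (W j)] [∀ j, NormedSpace ℝ (W j)] [∀ j, CompleteSpace (W j)]
    (ψf : ∀ m : massPatch δ s0, ∀ j, W j × V3 → W (j + 1)) (ρf : ∀ m : massPatch δ s0, ∀ j, W j × V3 → V3)
    (hψ : ∀ (j : ℕ) (m : massPatch δ s0) (g : ℝ) (x : W j × V3),
      x ∈ flowDomain (cutoffWeight Ω (jOmega (betaPT 4 L s0) Ω)) ((wsawQuadFlow L m.1).flow g) a hh j →
      ContinuousAt (fun p : massPatch δ s0 × (W j × V3) => ψf p.1 j p.2) (m, x))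
    (hρ : ∀ (j : ℕ) (m : massPatch δ s0) (g : ℝ) (x : W j × V3),
      x ∈ flowDomain (cutoffWeight Ω (jOmega (betaPT 4 L s0) Ω)) ((wsawQuadFlow L m.1).flow g) a hh j →
      ContinuousAt (fun p : massPatch δ s0 × (W j × V3) => ρf p.1 j p.2) (m, x))
    {q₀ : massPatch δ s0 × (W 0 × ℝ)}
    (hq₀ : AdmK (fun m : massPatch δ s0 => wsawQuadFlow L m.1) ψf ρf Ω B' c' (L ^ 2) C' a κ R M aStar b hh
      (jOmega (betaPT 4 L s0) Ω) q₀) (j : ℕ) :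
    ContinuousWithinAt
      (fun q => critFlowK ψf ρf hc
        (fun (m : massPatch δ s0) (g : ℝ) (hg : 0 < g)
            (hgle : g ≤ gThreshold Ω B' c' C' (L ^ 2) M a aStar κ R b hh) =>
          hpack.2 s0 m.1 hs0 hs0δ m.2.1 m.2.2.1 m.2.2.2 g hg (hgle.trans hgT)) q j)
      {q | AdmK (fun m : massPatch δ s0 => wsawQuadFlow L m.1) ψf ρf Ω B' c' (L ^ 2) C' a κ R M aStar b hh
        (jOmega (betaPT 4 L s0) Ω) q} q₀ :=
  critFlowK_continuousWithinAt ψf ρf hc _ (fun m => hpack.1 m.1 m.2.1.le m.2.2.1)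
    (coeffContinuous_wsawQuadFlow (by linarith) (fun s hs => hs.1.le)) hψ hρ hq₀ j

end CTWSAW

end Literature.Barriers.CriticalPhenomena
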